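import Summits.BirchSwinnertonDyer.BirchSwinnertonDyer.Theorems.ManinLocalTwoThreeNotTrivialEisensteinAtTwo
import Literature.NumberTheory.EllipticCurves.ModPIrreducibleCongruenceTransferProofs
import Literature.NumberTheory.EllipticCurves.ModPReducibility
import Literature.RepresentationTheory.FiniteGroups.InvariantLineOfFixedVectors
import HarnessLib

/-!
# Toward DDT's «`E[p]` irreducible (`p` odd) ⟹ `a_ℓ(E) mod p` is not a two-character Eisenstein system»:
# the plane lemmas and the Frobenius data of an element of `Γ_ℚ` relative to a root of unity in `ℚ(E[n])`

Summit `BirchSwinnertonDyer`, route `ManinLocalTwoThree` (cell bsd-f2-manin), crux C3 `ManinPrimeToThreeAtNine`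
(stmt-BirchSwinnertonDyer-22968), line `kato_shift_three` (lead p1, v6), stub `stub_notEisensteinOfIrreducible :
not_isEisensteinEigensystem_of_hasIrreducibleModPGaloisRep` — the named Literature fact (Darmon–Diamond–Taylor 1995,
Prop. 2.6 (b) + Lemma 4.12; `Literature/NumberTheory/EllipticCurves/ModPIrreducibleNotEisenstein.lean`).  MODULE 1 of an
ELEMENTARY proof (no Brauer–Nesbitt, no semisimplification), in the engine of the tree's
`not_irreducible_of_frobeniusTrace_congr_off_finite` / the lead's `notTrivialEisensteinOfIrreducibleAtTwo_holds`:

* §1 plane linear algebra: `apply_mem_ker_of_unipotent_of_fixed` (the fixed line of a unipotent `ρ g₁` is `ρ g`-stable as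
  soon as `ρ (g₁ · g g₁ g⁻¹)` fixes a non-zero vector — the tree's `apply_mem_ker_of_unipotent` with its blanket hypothesis
  localised to the one element it uses); `ker_sub_one_ne_bot_and_ne_top_of_mul_self_eq_one` (a non-scalar involution has a
  proper non-zero `+1`-eigenspace);
* §2 `natCast_not_mem_of_forall_prime_not_mem` (a natural number none of whose prime factors lies in a prime ideal does
  not lie in it); `frob_smul_eq_pow_of_pow_eq_one_of_not_dvd` (an arithmetic Frobenius over `ℓ` raises `n`-th roots of
  unity to the `ℓ`-th power when `ℓ ∤ n`; Tate GCFT §3.4 / Mathlib `IsArithFrobAt.apply_of_pow_eq_one`);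
* §3 `exists_prime_frobenius_data`: for `W/ℚ` globally minimal, `p ∣ n`, `ζ` an `n`-th root of unity fixed by the
  pointwise stabiliser of `W[n]`, and ANY `σ ∈ Γ_ℚ`: Chebotarev (`chebotarev_geomTorsion_holds`) supplies a good prime
  `ℓ ∉ S`, `ℓ ∤ n`, `ℓ ≠ p`, with `σ ζ = ζ^ℓ`, `det(σ | W[p]) = ℓ` (`det_galoisRepTorsion_frobenius_eq`), and
  `p ∣ #W̃(𝔽_ℓ) ⟹ σ` fixes a non-zero point of `W[p]` (`exists_frobenius_smul_eq_of_dvd_reductionPointCount_holds`).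

No definitions; nothing about BSD or the Manin constant is asserted here.
-/

set_option autoImplicit false
set_option linter.dupNamespace false

noncomputable section

open scoped Classical

open NumberField IsDedekindDomain Field WeierstrassCurve Module
  Literature.NumberTheory.EllipticCurves Literature.NumberTheory.GaloisRepresentations

namespace Summit.BirchSwinnertonDyer.BirchSwinnertonDyer.Theorems.ManinLocalTwoThree

/-! ### §1  Plane linear algebra -/

section Plane

variable {k V : Type*} [Field k] [AddCommGroup V] [Module k V] {G : Type*} [Group G]

open Literature.RepresentationTheory.FiniteGroups.Representation

/-- **The fixed line of a unipotent element is stable under `ρ g` once `ρ (g₁ · g g₁ g⁻¹)` fixes a non-zero vector.**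
This is the tree's `apply_mem_ker_of_unipotent` (file `InvariantLineOfFixedVectors`) with its hypothesis «every element
of the image fixes a non-zero vector» localised to the single element the proof uses; the proof is copied verbatim
otherwise (adapted from `Literature/RepresentationTheory/FiniteGroups/InvariantLineOfFixedVectors.lean`). [folklore] -/
theorem apply_mem_ker_of_unipotent_of_fixed (ρ : _root_.Representation k G V) (h2 : finrank k V = 2)
    {g₁ : G} (hne : ρ g₁ ≠ 1) (hsq : (ρ g₁ - 1) * (ρ g₁ - 1) = 0) (g : G)
    (hfix : ∃ v : V, v ≠ 0 ∧ ρ (g₁ * (g * g₁ * g⁻¹)) v = v) :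
    ∀ x ∈ LinearMap.ker (ρ g₁ - 1), ρ g x ∈ LinearMap.ker (ρ g₁ - 1) := by
  haveI : FiniteDimensional k V := Module.finite_of_finrank_eq_succ h2
  set N : Module.End k V := ρ g₁ - 1 with hN_def
  have hN0 : N ≠ 0 := sub_ne_zero.mpr hne
  obtain ⟨hrange, hL1⟩ := range_eq_ker_of_mul_self_eq_zero h2 hN0 hsq
  have hinv1 : ∀ x, ρ g (ρ g⁻¹ x) = x := fun x ↦ by
    rw [← Module.End.mul_apply, ← map_mul, mul_inv_cancel, map_one, Module.End.one_apply]
  have hinv2 : ∀ x, ρ g⁻¹ (ρ g x) = x := fun x ↦ by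
    rw [← Module.End.mul_apply, ← map_mul, inv_mul_cancel, map_one, Module.End.one_apply]
  set M : Submodule k V := (LinearMap.ker N).map (ρ g) with hM_def
  have hM1 : finrank k M = 1 := by
    let e : V ≃ₗ[k] V :=
      LinearEquiv.ofLinear (ρ g) (ρ g⁻¹) (LinearMap.ext hinv1) (LinearMap.ext hinv2)
    have he : M = (LinearMap.ker N).map (e : V →ₗ[k] V) := rfl
    rw [he, LinearEquiv.finrank_map_eq, hL1]
  by_contra hcontra
  push Not at hcontra
  obtain ⟨x, hxL, hxnot⟩ := hcontra
  have hLM : LinearMap.ker N ≠ M := by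
    intro hEq
    exact hxnot (hEq ▸ Submodule.mem_map_of_mem hxL)
  set N' : Module.End k V := ρ g * N * ρ g⁻¹ with hN'_def
  have hN'apply : ∀ v, N' v = ρ g (N (ρ g⁻¹ v)) := fun v ↦ rfl
  have hu : ρ g₁ = 1 + N := by rw [hN_def]; abel
  have hconj : ρ (g * g₁ * g⁻¹) = 1 + N' := by
    rw [map_mul, map_mul, hu, hN'_def, mul_add, mul_one, add_mul, ← map_mul ρ g g⁻¹,
      mul_inv_cancel, map_one]
  obtain ⟨v, hv0, hv⟩ := hfix
  rw [map_mul, hconj, hu] at hv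
  have hNN : ∀ y, N (N y) = 0 := fun y ↦ by
    rw [← Module.End.mul_apply, hsq, LinearMap.zero_apply]
  have key : N' v + N v + N (N' v) = 0 := by
    have h := hv
    simp only [Module.End.mul_apply, LinearMap.add_apply, Module.End.one_apply, map_add] at h
    have h' : v + (N' v + N v + N (N' v)) = v + 0 := by
      rw [add_zero]
      calc v + (N' v + N v + N (N' v)) = v + N v + (N' v + N (N' v)) := by abel
        _ = v := h
    exact add_left_cancel h'
  have key2 : N (N' v) = 0 := by
    have h := congr_arg N key
    rwa [map_add, map_add, hNN, hNN, map_zero, add_zero, add_zero] at h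
  have hN'vL : N' v ∈ LinearMap.ker N := key2
  have hN'vM : N' v ∈ M := by
    rw [hN'apply]
    refine Submodule.mem_map_of_mem ?_
    rw [← hrange]
    exact LinearMap.mem_range_self N _
  have hN'v0 : N' v = 0 := by
    by_contra h
    exact hLM (eq_of_finrank_eq_one_of_mem hL1 hM1 h hN'vL hN'vM)
  have hNv0 : N v = 0 := by
    rw [hN'v0, map_zero, zero_add, add_zero] at key
    exact key
  have hvL : v ∈ LinearMap.ker N := hNv0
  have hvM : v ∈ M := by
    have h1 : N (ρ g⁻¹ v) = 0 := by
      have h := congr_arg (ρ g⁻¹) hN'v0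
      rwa [hN'apply, hinv2, map_zero] at h
    rw [← hinv1 v]
    exact Submodule.mem_map_of_mem (f := ρ g) h1
  exact hLM (eq_of_finrank_eq_one_of_mem hL1 hM1 hv0 hvL hvM)

/-- **A non-scalar involution has a proper non-zero `+1`-eigenspace**: if `f² = 1`, `f ≠ 1`, `f ≠ -1`, then
`ker (f - 1)` is neither `⊥` (else `f - 1` is injective and `(f - 1)(f + 1) = 0` forces `f = -1`) nor `⊤`. [folklore] -/
theorem ker_sub_one_ne_bot_and_ne_top_of_mul_self_eq_one {f : Module.End k V} (hff : f * f = 1) (h1 : f ≠ 1)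
    (hm1 : f ≠ -1) : LinearMap.ker (f - 1) ≠ ⊥ ∧ LinearMap.ker (f - 1) ≠ ⊤ := by
  constructor
  · intro hbot
    apply hm1
    have hinj := LinearMap.ker_eq_bot.1 hbot
    have hprod : (f - 1) * (f + 1) = 0 := by
      rw [mul_add, sub_mul, sub_mul, mul_one, one_mul, mul_one, hff]; abel
    have hzero : f + 1 = 0 := by
      ext v
      apply hinj
      rw [← Module.End.mul_apply, hprod, LinearMap.zero_apply]
      exact ((f - 1).map_zero).symm
    exact eq_neg_of_add_eq_zero_left hzero
  · intro htop
    apply h1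
    ext v
    have hv : v ∈ LinearMap.ker (f - 1) := by rw [htop]; exact Submodule.mem_top
    rw [LinearMap.mem_ker, LinearMap.sub_apply, Module.End.one_apply, sub_eq_zero] at hv
    rw [hv, Module.End.one_apply]

end Plane

/-! ### §2  Arithmetic preliminaries -/

section Arith

/-- **A natural number none of whose prime factors lies in a prime ideal does not lie in it.** [folklore] -/
theorem natCast_not_mem_of_forall_prime_not_mem {R : Type*} [CommRing R] {P : Ideal R} (hP : P.IsPrime) :
    ∀ {n : ℕ}, n ≠ 0 → (∀ q : ℕ, q.Prime → q ∣ n → (q : R) ∉ P) → (n : R) ∉ P := by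
  intro n
  induction n using Nat.strong_induction_on with
  | _ n ih =>
    intro hn h hmem
    by_cases h1 : n = 1
    · subst h1
      rw [Nat.cast_one] at hmem
      exact hP.ne_top ((Ideal.eq_top_iff_one P).2 hmem)
    · have hq : n.minFac.Prime := Nat.minFac_prime h1
      obtain ⟨n', hn'⟩ := Nat.minFac_dvd n
      have hn'0 : n' ≠ 0 := by rintro rfl; rw [mul_zero] at hn'; exact hn hn'
      have hlt : n' < n := by
        rw [hn'] ; exact lt_mul_of_one_lt_left (Nat.pos_of_ne_zero hn'0) hq.one_lt
      have hcast : (n : R) = (n.minFac : R) * (n' : R) := by rw [← Nat.cast_mul, ← hn']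
      rw [hcast] at hmem
      rcases hP.mem_or_mem hmem with hmem | hmem
      · exact h _ hq (Nat.minFac_dvd n) hmem
      · exact ih n' hlt hn'0 (fun q hq' hqd => h q hq' (dvd_trans hqd (Dvd.intro_left _ hn'.symm))) hmem

/-- **An arithmetic Frobenius over `ℓ` raises `n`-th roots of unity to the `ℓ`-th power when `ℓ ∤ n`** (`n > 0`; Tate,
GCFT §3.4; Mathlib `IsArithFrobAt.apply_of_pow_eq_one` in `\bar ℤ`; the tree's `frob_smul_eq_pow_of_pow_eq_one` is the
case `n = 2^k`). [cite: TateGCFT1967, §3.4 Proposition (PDF p. 208)] -/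
theorem frob_smul_eq_pow_of_pow_eq_one_of_not_dvd {ℓ n : ℕ} (hℓ : ℓ.Prime) (hn : 0 < n) (hℓn : ¬ ℓ ∣ n)
    {v : HeightOneSpectrum (𝓞 ℚ)} (hv : (ℓ : 𝓞 ℚ) ∈ v.asIdeal) {𝔓 : Ideal (absIntegers (𝓞 ℚ) ℚ)}
    (h𝔓 : 𝔓 ∈ v.primesAbove) {φ : absoluteGaloisGroup ℚ} (hφ : IsArithFrobAt (𝓞 ℚ) φ 𝔓)
    {ζ : AlgebraicClosure ℚ} (hζ : ζ ^ n = 1) : φ • ζ = ζ ^ ℓ := by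
  haveI : 𝔓.IsPrime := h𝔓.1
  haveI : NeZero n := ⟨hn.ne'⟩
  have hvℓ : (Rat.HeightOneSpectrum.primesEquiv v : ℕ) = ℓ := primesEquiv_eq_of_natCast_mem hℓ hv
  have hζi : IsIntegral (𝓞 ℚ) ζ := IsIntegral.of_pow hn (by rw [hζ]; exact isIntegral_one)
  set x : absIntegers (𝓞 ℚ) ℚ := ⟨ζ, hζi⟩ with hx
  have hxN : x ^ n = 1 := Subtype.ext (by simp [hx, hζ])
  -- `n ∉ 𝔓`: no prime factor of `n` lies in `v`
  have hm : ((n : ℕ) : absIntegers (𝓞 ℚ) ℚ) ∉ 𝔓 := by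
    intro h
    have h' : ((n : ℕ) : 𝓞 ℚ) ∈ v.asIdeal := by
      rw [h𝔓.2.over, Ideal.mem_under, map_natCast]; exact h
    refine natCast_not_mem_of_forall_prime_not_mem v.isPrime hn.ne' (fun q hq hqn hqv => ?_) h'
    have : (Rat.HeightOneSpectrum.primesEquiv v : ℕ) = q := primesEquiv_eq_of_natCast_mem hq hqv
    rw [hvℓ] at this
    exact hℓn (this ▸ hqn)
  have h := hφ.apply_of_pow_eq_one hxN hm
  rw [MulSemiringAction.toAlgHom_apply, HeightOneSpectrum.card_quotient_under_eq_residueCard h𝔓] at h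
  have hres : v.residueCard = ℓ := by rw [FramedRep.residueCard_eq_coe_primesEquiv', hvℓ]
  have h' := congrArg (fun z : absIntegers (𝓞 ℚ) ℚ ↦ (z : AlgebraicClosure ℚ)) h
  simpa [hx, integralClosure.coe_smul, hres] using h'

end Arith

/-! ### §3  Frobenius data of an element of `Γ_ℚ` relative to `ζ ∈ ℚ(W[n])` -/

section FrobData

variable (W : WeierstrassCurve ℚ) [W.IsElliptic] [W.IsGloballyMinimal]

/-- **Frobenius data of `σ ∈ Γ_ℚ`** (`W` globally minimal, `p` prime, `p ∣ n`, `ζ^n = 1` with `ζ` fixed by the pointwise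
stabiliser of `W[n]`, `S` finite): there is a prime `ℓ ∉ S`, `ℓ ≠ p`, `ℓ ∤ n`, of good reduction, such that
`σ ζ = ζ^ℓ`, `det(σ | W[p]) = ℓ mod p`, and if `p ∣ #W̃(𝔽_ℓ)` then `σ` fixes a non-zero point of `W[p]` — `ℓ` being a
prime whose Frobenius acts on `W[n]` as `σ` (Chebotarev, `chebotarev_geomTorsion_holds`).
[cite: TateGCFT1967, §2.4 (Tchebotarev density theorem)] -/
theorem exists_prime_frobenius_data (p : ℕ) [Fact p.Prime] {n : ℕ} (hn : 0 < n) (hpn : p ∣ n) (S : Finset ℕ)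
    {ζ : AlgebraicClosure ℚ} (hζn : ζ ^ n = 1)
    (hζfix : ∀ τ : absoluteGaloisGroup ℚ, (∀ T : W.geomTorsion (n : ℤ), τ • T = T) → τ • ζ = ζ)
    (σ : absoluteGaloisGroup ℚ) :
    ∃ (ℓ : ℕ) (_ : Fact ℓ.Prime), ℓ ∉ S ∧ ℓ ≠ p ∧ ¬ ℓ ∣ n ∧ W.HasGoodReductionAtPrime ℓ ∧ σ • ζ = ζ ^ ℓ ∧
      (letI : Module (ZMod p) (W.geomTorsion (p : ℤ)) := AddSubgroup.torsionBy.zmodModule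
       LinearMap.det ((W.galoisRepTorsion (p : ℤ) σ).toAdd.toAddMonoidHom.toZModLinearMap p) = (ℓ : ZMod p)) ∧
      (p ∣ W.reductionPointCount ℓ → ∃ P : W.geomTorsion (p : ℤ), P ≠ 0 ∧ σ • P = P) := by
  classical
  have hp : p.Prime := Fact.out
  have hΔ0 : minimalDiscriminantInt W ≠ 0 := minimalDiscriminantInt_ne_zero W
  let S' : Set ℕ := {ℓ | ℓ = p ∨ ℓ ∣ n ∨ (ℓ : ℤ) ∣ minimalDiscriminantInt W ∨ ℓ ∈ S}
  have hS' : S'.Finite := by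
    refine ((Set.finite_le_nat (max p (max n (minimalDiscriminantInt W).natAbs))).union
      (S : Set ℕ).toFinite).subset ?_
    rintro ℓ (rfl | hℓ | hℓ | hℓ)
    · exact Or.inl (Set.mem_setOf.mpr (le_max_left _ _))
    · exact Or.inl (Set.mem_setOf.mpr (le_max_of_le_right (le_max_of_le_left (Nat.le_of_dvd hn hℓ))))
    · exact Or.inl (Set.mem_setOf.mpr (le_max_of_le_right (le_max_of_le_right
        (Nat.le_of_dvd (Int.natAbs_pos.mpr hΔ0) (Int.natCast_dvd.mp hℓ)))))
    · exact Or.inr hℓ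
  obtain ⟨ℓ, v, 𝔓, φ, hℓ, hℓS, hv, h𝔓, hφ, hagree⟩ :=
    chebotarev_geomTorsion_holds W (n : ℤ) (by exact_mod_cast hn.ne') S' hS' σ
  haveI : Fact ℓ.Prime := ⟨hℓ⟩
  have hℓp : ℓ ≠ p := fun h ↦ hℓS (Or.inl h)
  have hℓn : ¬ ℓ ∣ n := fun h ↦ hℓS (Or.inr (Or.inl h))
  have hℓΔ : ¬ (ℓ : ℤ) ∣ minimalDiscriminantInt W := fun h ↦ hℓS (Or.inr (Or.inr (Or.inl h)))
  have hℓS₀ : ℓ ∉ S := fun h ↦ hℓS (Or.inr (Or.inr (Or.inr h)))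
  have hgood : W.HasGoodReductionAtPrime ℓ := hasGoodReductionAtPrime_of_not_dvd W ℓ hℓΔ
  have hvℓ : (Rat.HeightOneSpectrum.primesEquiv v : ℕ) = ℓ := primesEquiv_eq_of_natCast_mem hℓ hv
  -- `φ ζ = σ ζ` and `φ ζ = ζ ^ ℓ`
  have hφζ : φ • ζ = σ • ζ := by
    have h1 : (σ⁻¹ * φ) • ζ = ζ := hζfix _ fun T ↦ by rw [mul_smul, hagree T, inv_smul_smul]
    rw [mul_smul] at h1
    have h2 := congrArg (fun x ↦ σ • x) h1
    simpa only [smul_inv_smul] using h2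
  have hfrob := frob_smul_eq_pow_of_pow_eq_one_of_not_dvd hℓ hn hℓn hv h𝔓 hφ hζn
  -- `φ` and `σ` agree on `W[p] ⊆ W[n]`
  have hagree_p : ∀ P : W.geomTorsion (p : ℤ), φ • P = σ • P := by
    intro P
    have hPn : (P : W.geomPoints) ∈ W.geomTorsion (n : ℤ) := by
      have hP : ((p : ℕ) : ℤ) • (P : W.geomPoints) = 0 := by
        simpa only [AddSubgroup.torsionBy, Submodule.mem_toAddSubgroup, Submodule.mem_torsionBy_iff] using P.2
      simp only [Submodule.mem_toAddSubgroup, Submodule.mem_torsionBy_iff]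
      obtain ⟨c, hc⟩ := hpn
      rw [hc, Nat.cast_mul, mul_comm, mul_smul]
      show (c : ℤ) • (((p : ℕ) : ℤ) • (P : W.geomPoints)) = 0
      rw [hP, smul_zero]
    have h := congrArg Subtype.val (hagree ⟨P, hPn⟩)
    apply Subtype.ext
    rw [AddSubgroup.torsionBy.coe_smul, AddSubgroup.torsionBy.coe_smul]
    exact h
  refine ⟨ℓ, ⟨hℓ⟩, hℓS₀, hℓp, hℓn, hgood, by rw [← hφζ, hfrob], ?_, fun hdvd ↦ ?_⟩
  · -- determinant
    letI : Module (ZMod p) (W.geomTorsion (p : ℤ)) := AddSubgroup.torsionBy.zmodModule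
    have heq : (W.galoisRepTorsion (p : ℤ) σ).toAdd.toAddMonoidHom.toZModLinearMap p =
        (W.galoisRepTorsion (p : ℤ) φ).toAdd.toAddMonoidHom.toZModLinearMap p := by
      apply LinearMap.ext
      intro P
      show (Multiplicative.toAdd (W.galoisRepTorsion (p : ℤ) σ)) P =
        (Multiplicative.toAdd (W.galoisRepTorsion (p : ℤ) φ)) P
      rw [galoisRepTorsion_apply, galoisRepTorsion_apply, hagree_p]
    rw [heq]
    exact W.det_galoisRepTorsion_frobenius_eq p hℓp hgood hvℓ h𝔓 hφ
  · obtain ⟨P, hP0, hP⟩ :=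
      exists_frobenius_smul_eq_of_dvd_reductionPointCount_holds W p ℓ hℓp hgood hdvd v hv 𝔓 h𝔓 φ hφ
    exact ⟨P, hP0, by rw [← hagree_p, hP]⟩

end FrobData

end Summit.BirchSwinnertonDyer.BirchSwinnertonDyer.Theorems.ManinLocalTwoThree

end
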